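import Mathlib
import HarnessLib
import Summits.HubbardSuperconductivity.HubbardSuperconductivity.Theorems.KLProgrammeKLRegimeEngineTowerLevBridgeSwSigma
import Summits.HubbardSuperconductivity.HubbardSuperconductivity.Theorems.KLProgrammeKLRegimeEngineTowerLevBridgeSucc
import Summits.HubbardSuperconductivity.HubbardSuperconductivity.Theorems.KLProgrammeKLRegimeEngineTowerLevelAntitone

/-!
# Route `KLProgramme` — crux K3 ENGINE (stmt-HubbardSuperconductivity-20437 `KLRegimeEngineV17F2`), stub (b) v2, THE LEVELS PACKAGE (ℓ), located-risk #10,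
# instantiation (I2) PIN-CREDITED: the SWAPPED (position-only-pin) door input of the tower's block input against the measured levelled arrays
# AT THE SHARP LEVEL (located «(ℓ)-LEV-INST-PINCREDIT», KL STATUS 2026-08-28; cell gate-hubbard-kl, seat hubbard-kl-k3c2-p3 g14 — E1 may rename or supersede)

k3c3-p2's `…TowerLevBridgeSwSigma` §2 reads the sector-dependent-pin swapped input (`|E| = F₀ + 1`, free leg `t`, pin `x_t = y(σ_t)`) of `𝒱_{dk}` at `F_{dk−1}`
against `klTowerMeasLev … F₀` — through the pin-UNcredited standard bridge `doorInput_of_levelBounds` (…TowerLevBridge §1, prescription `τ on E ∖ {q}`).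
Feeding the SAME generic transformers (`swSigmaInput_of_stdInput_unweighted`, `swSigmaInput_levelZero_of_stdInput`) with the pin-CREDITED bridge
`doorInput_of_levelBounds_succ` (…TowerLevBridgeSucc, prescription `τ on E`, level `|E|`) gives the sharp rows the oriented door's (I3) dictionary needs
(a vertex with `Lv` known sectors is charged at level `Lv`, and the floor units pay `2^{−lumps(Lv)·J}` exactly at that level):

* **`swSigmaInput_klTowerInput_le_klTowerMeasLev_succ`** — `|E| = F₀ + 1`, any leg `t`, any `y : sector → position`: `≤ klTowerMeasLev … d k (m+1) (F₀ + 1)`;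
* **`swSigmaInput_klTowerInput_levelZero_le_one`** — `|E| = 0`: `≤ |SectorLeg (sectorCount (dk−1))| · klTowerMeasLev … d k (m+1) 1`;
* `klTowerMeasLev_zero_le_one` — the level-`0` array is at most the level-`1` array (a leg sum pinned at `(p, s)` is already prescribed at `p`), hence
  `klTowerMeasLev_zero_eq_one` (with `klTowerMeasLev_anti`): levels `0` and `1` carry the same datum (one known sector — the pinned leg's).
Proofs only; nothing about the model is asserted; nothing asserts (ℓ), any stub, K3 or superconductivity.
References: BGM 2006 §2.8 (2.76)–(2.77), (2.88)–(2.90), App. A4 (A4.8) [cite: BenfattoGiulianiMastropietro2006].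
-/

noncomputable section

namespace Summit.HubbardSuperconductivity.HubbardSuperconductivity.Theorems.EngineV8

set_option linter.dupNamespace false -- summit = problem name (single-conjunct summit), D-0017

open Classical
open Real Finset Literature.MathematicalPhysics.QuantumLattice Literature.Probability.LatticeModels GrassmannAlgebra
open Literature.MathematicalPhysics.QuantumLattice.FermiRG
open Summit.HubbardSuperconductivity.HubbardSuperconductivity.Theorems.KLRegimeSplit
open Summit.HubbardSuperconductivity.HubbardSuperconductivity.Theorems.KLProgrammeLegKernels
open Summit.HubbardSuperconductivity.HubbardSuperconductivity.Theorems.DispersionFlow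
open Summit.HubbardSuperconductivity.HubbardSuperconductivity.Theorems.KLRegimeWick

variable {L M : ℕ} [NeZero L] [NeZero M]

/-! ## §1 The swapped input rows at the sharp level -/

/-- **TOWER FORM, UNWEIGHTED, PIN-CREDITED**: the sector-dependent-pin swapped input of `𝒱_{dk}` at `F_{dk−1}` with `|E| = F₀ + 1` (any free leg `t`, any
`y : sector → position`) is `≤ klTowerMeasLev L M β U μ K d k (m+1) (F₀ + 1)` (`0 < β`) — the `|E|` known sectors are charged AT level `|E|`. -/
theorem swSigmaInput_klTowerInput_le_klTowerMeasLev_succ {β : ℝ} (hβ : 0 < β) (U μ : ℝ) (K : TrigPolyC4v) (d k : ℕ) {m F₀ : ℕ}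
    (E : Finset (Fin (m + 1))) (τ : Fin (m + 1) → SectorLeg (sectorCount (d * k - 1))) (t : Fin (m + 1)) (hE : E.card = F₀ + 1)
    (yσ : SectorLeg (sectorCount (d * k - 1)) → SpaceTimeIdx L M) :
    imagTimeWeight β M ^ m * ∑ σ ∈ univ.filter (fun σ : Fin (m + 1) → SectorLeg (sectorCount (d * k - 1)) => ∀ e ∈ E, σ e = τ e),
        ∑ x ∈ univ.filter (fun x : Fin (m + 1) → SpaceTimeIdx L M => x t = yσ (σ t)),
          ‖sectorisedKernel L M β (klAnisoFamily L M β μ K klE0 (d * k - 1)) (klTowerInput L M β U μ K d k) (m + 1) σ x‖ ≤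
      klTowerMeasLev L M β U μ K d k (m + 1) (F₀ + 1) :=
  swSigmaInput_of_stdInput_unweighted hβ μ K (d * k - 1) (klTowerInput L M β U μ K d k)
    (fun _ _ hX => kernel_klEffectiveAction_eq_zero_of_freq β U μ K klE0 (d * k) hX)
    (fun m' X hX => klEffectiveAction_momentumConserving β U μ K klE0 (d * k) m' X hX)
    (fun E' τ' p hp hE' y => doorInput_of_levelBounds_succ hβ.le μ K (d * k - 1) (klTowerInput L M β U μ K d k)
      (fun m' X hX => klEffectiveAction_momentumConserving β U μ K klE0 (d * k) m' X hX)
      (fun F => klTowerMeasLev L M β U μ K d k (m + 1) F) (fun Ωe' => klLevNormOf_le_klTowerMeasLev β U μ K d k (m + 1) Ωe') F₀ E' τ' p hp hE' y)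
    E τ t hE yσ

/-- **TOWER FORM, UNWEIGHTED, LEVEL `0`, PIN-CREDITED**: with `|E| = 0` the sector-dependent-pin swapped input of `𝒱_{dk}` at `F_{dk−1}` is
`≤ |SectorLeg (sectorCount (dk−1))| · klTowerMeasLev L M β U μ K d k (m+1) 1` (`0 ≤ β`; each fibre `σ_t = s₀` is a standard input with `E = {t}`, ONE known sector,
charged at level `1`). -/
theorem swSigmaInput_klTowerInput_levelZero_le_one {β : ℝ} (hβ : 0 ≤ β) (U μ : ℝ) (K : TrigPolyC4v) (d k : ℕ) {m : ℕ}
    (E : Finset (Fin (m + 1))) (τ : Fin (m + 1) → SectorLeg (sectorCount (d * k - 1))) (t : Fin (m + 1)) (hE : E.card = 0)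
    (yσ : SectorLeg (sectorCount (d * k - 1)) → SpaceTimeIdx L M) :
    imagTimeWeight β M ^ m * ∑ σ ∈ univ.filter (fun σ : Fin (m + 1) → SectorLeg (sectorCount (d * k - 1)) => ∀ e ∈ E, σ e = τ e),
        ∑ x ∈ univ.filter (fun x : Fin (m + 1) → SpaceTimeIdx L M => x t = yσ (σ t)),
          ‖sectorisedKernel L M β (klAnisoFamily L M β μ K klE0 (d * k - 1)) (klTowerInput L M β U μ K d k) (m + 1) σ x‖ ≤
      Fintype.card (SectorLeg (sectorCount (d * k - 1))) * klTowerMeasLev L M β U μ K d k (m + 1) 1 := by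
  have h := swSigmaInput_levelZero_of_stdInput (klAnisoFamily L M β μ K klE0 (d * k - 1)) (klTowerInput L M β U μ K d k) (fun _ => (1 : ℝ))
    (m := m) (B := klTowerMeasLev L M β U μ K d k (m + 1) (0 + 1))
    (fun E' τ' p hp hE' y => by
      simpa only [one_mul] using doorInput_of_levelBounds_succ hβ μ K (d * k - 1) (klTowerInput L M β U μ K d k)
        (fun m' X hX => klEffectiveAction_momentumConserving β U μ K klE0 (d * k) m' X hX)
        (fun F => klTowerMeasLev L M β U μ K d k (m + 1) F) (fun Ωe' => klLevNormOf_le_klTowerMeasLev β U μ K d k (m + 1) Ωe') 0 E' τ' p hp hE' y)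
    E τ t hE yσ
  simpa only [one_mul, zero_add] using h

/-! ## §2 Levels `0` and `1` carry the same datum -/

omit [NeZero M] in
/-- **A level-`0` leg sum is a level-`1` leg sum**: for the empty prescription, the leg sum pinned at `(p, s, x)` equals the leg sum of the prescription
«`p ↦ s`» pinned at the same data (prescribing the pinned leg's own sector drops nothing). -/
theorem sectorLegSum_prescribedTuples_none_eq_single {N m : ℕ} (ε : ℝ) (A : Finset (Fin (m + 1) → SectorLeg N))
    (W : (Fin (m + 1) → SectorLeg N) → (Fin (m + 1) → SpaceTimeIdx L M) → ℂ) (p : Fin (m + 1)) (s : SectorLeg N) (x : SpaceTimeIdx L M) :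
    sectorLegSum ε (prescribedTuples A (fun _ : Fin (m + 1) => (none : Option (SectorLeg N)))) W p s x =
      sectorLegSum ε (prescribedTuples A (fun i : Fin (m + 1) => if i = p then some s else none)) W p s x := by
  rw [sectorLegSum_def, sectorLegSum_def]
  refine sum_congr ?_ fun _ _ => rfl
  ext Ω
  simp only [prescribedTuples, mem_filter, Option.mem_def]
  constructor
  · rintro ⟨⟨hA, -⟩, hp⟩
    refine ⟨⟨hA, fun i s' hs' => ?_⟩, hp⟩
    split_ifs at hs' with hi
    · subst hi; exact hp.trans (Option.some.inj hs')
  · rintro ⟨⟨hA, -⟩, hp⟩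
    exact ⟨⟨hA, fun i s' hs' => by simp at hs'⟩, hp⟩

omit [NeZero L] [NeZero M] in
/-- The prescription «`p ↦ s`» has level `1`. -/
theorem levelCount_single {N m : ℕ} (p : Fin (m + 1)) (s : SectorLeg N) :
    levelCount (fun i : Fin (m + 1) => if i = p then some s else none) = 1 := by
  unfold levelCount
  have h : (univ.filter fun i : Fin (m + 1) => (if i = p then some s else none).isSome) = {p} := by
    ext i
    simp only [mem_filter, mem_univ, true_and, mem_singleton]
    by_cases hi : i = p <;> simp [hi]
  rw [h, card_singleton]

omit [NeZero L] [NeZero M] in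
/-- A level-`0` prescription is the empty one. -/
theorem eq_none_of_levelCount_eq_zero {N m : ℕ} {Ωe : Fin m → Option (SectorLeg N)} (h : levelCount Ωe = 0) :
    Ωe = fun _ => none := by
  funext i
  rw [levelCount, Finset.card_eq_zero, Finset.filter_eq_empty_iff] at h
  exact Option.not_isSome_iff_eq_none.mp (h (mem_univ i))

omit [NeZero M] in
/-- **The level-`0` measured array is at most the level-`1` one**: `klTowerMeasLev … d k (m+1) 0 ≤ klTowerMeasLev … d k (m+1) 1` (`0 ≤ β`). -/
theorem klTowerMeasLev_zero_le_one {β : ℝ} (hβ : 0 ≤ β) (U μ : ℝ) (K : TrigPolyC4v) (d k m : ℕ) :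
    klTowerMeasLev L M β U μ K d k (m + 1) 0 ≤ klTowerMeasLev L M β U μ K d k (m + 1) 1 := by
  have h1 := klTowerMeasLev_nonneg (L := L) (M := M) hβ U μ K d k (m + 1) 1
  unfold klTowerMeasLev at h1 ⊢
  rcases isEmpty_or_nonempty {Ωe : Fin (m + 1) → Option (SectorLeg (sectorCount (d * k - 1))) // levelCount Ωe = 0} with h | h
  · rw [Real.iSup_of_isEmpty]; exact h1
  · refine ciSup_le fun Ωe => ?_
    have hΩ : Ωe.1 = fun _ => none := eq_none_of_levelCount_eq_zero Ωe.2
    rw [hΩ, klLevNormOf, hubbardSectorKernelNorm_def]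
    refine sectorisedKernelNorm_le_of_forall_le h1 fun p s x => ?_
    rw [sectorLegSum_prescribedTuples_none_eq_single]
    refine (sectorLegSum_le_sectorisedKernelNorm (imagTimeWeight β M) _ _ p s x).trans ?_
    have hle := klLevNormOf_le_klTowerMeasLev (L := L) (M := M) β U μ K d k (m + 1) (fun i : Fin (m + 1) => if i = p then some s else none)
    rw [levelCount_single, klLevNormOf, hubbardSectorKernelNorm_def] at hle
    unfold klTowerMeasLev at hle
    exact hle

omit [NeZero M] in
/-- **Levels `0` and `1` of the measured array coincide** (`0 ≤ β`). -/
theorem klTowerMeasLev_zero_eq_one {β : ℝ} (hβ : 0 ≤ β) (U μ : ℝ) (K : TrigPolyC4v) (d k m : ℕ) :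
    klTowerMeasLev L M β U μ K d k (m + 1) 0 = klTowerMeasLev L M β U μ K d k (m + 1) 1 :=
  le_antisymm (klTowerMeasLev_zero_le_one hβ U μ K d k m) (klTowerMeasLev_anti hβ U μ K d k (m + 1) zero_le_one)

end Summit.HubbardSuperconductivity.HubbardSuperconductivity.Theorems.EngineV8

end
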